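import Summits.AtomisticToContinuum.HydrodynamicLimit.Theorems.AntiMazurCoboundariesInfluenceLocalityFirstMoment
import HarnessLib

/-!
# Line `slab-percolation-shadow` (lead a1) for crux `InfluenceLocality` (stmt-AtomisticToContinuum-13916) — SKELETON, rev 4

Lead-owned skeleton (prover-line-stmt-AtomisticToContinuum-13916-a1-0), registered with
`--crux-decl Summit.AtomisticToContinuum.HydrodynamicLimit.Theorems.TrueAnchoredInfection.FirstMomentInfluenceLocality`.
TARGET: the FIRST-MOMENT restatement `FirstMomentInfluenceLocality` of the crux (eventual in `R`, uniform in `N`; restatement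
(A), objects module `…FirstMomentObjects`, p106319), concluded BY NAME by `FirstMomentInfluenceLocality_of`. The TYPED decl
`AntiMazurCoboundaries.InfluenceLocality` (`∀ lam` exponential moments) is reached only through the explicit LD-upgrade hypothesis of
`InfluenceLocality_of_ldUpgrade` — NOT a stub: the typed form is held FALSE above `lam_c(T,σ,θ)` by every seat (steered dispersal
cascades; `PICKED.md`, `RETYPE.md`); the item is reported MIS-STATED.

STATUS (2026-08-16, lead a1): everything but `G_free` is LANDED —
* objects `…FirstMomentObjects` (p106319); dead-line stubs `stub_forecastWorldsGood` (p91209), `stub_energyDomination` (p91351),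
  `stub_anchoredCovering` (p97019), `stub_trueCapsExist` (p95475);
* the slab lever: `stub_nearChainBound` (p111814), `stub_nearChainOfChain` (p111812), `stub_tailArith` (p111813), assembled into
  `stub_tightChainTail` (`…TightChainTail.lean`, `tightChainTail_of`);
* the composition `firstMoment_of_stubs` and the conditional closing theorem
  `firstMoment_of_forecastCaps : ForecastCapsExist → FirstMomentInfluenceLocality` (`…FirstMoment.lean`);
* `G_free`: `stub_forecastCapsExist_reduction : ForecastCapsExist ↔ (∀ … ForecastClusterCardTail σ a θ u₀ T ⌊√·⌋₊)` (p107089) — the ONLY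
  remaining `sorry` below is this one named Prop (backward-cluster cardinality tail of the FREE isolated Gibbs droplet; no tool beyond one
  Lanford window at fixed density; deleted by the WALLED frozen-exterior re-typing of the forecast, `RETYPE.md` §3, `G_FREE.md`).
-/

namespace Summit.AtomisticToContinuum.HydrodynamicLimit.Theorems.TrueAnchoredInfection

open Summit.AtomisticToContinuum.HydrodynamicLimit.Theses.AntiMazurCoboundaries (InfluenceLocality)

noncomputable section

/-! ## Registered stubs (the only `sorry` of this file) -/

-- stub_forecastWorldsGood, stub_energyDomination, stub_anchoredCovering, stub_trueCapsExist — LANDED (dead line), imported.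
-- stub_nearChainBound (p111814), stub_nearChainOfChain (p111812), stub_tailArith (p111813) — LANDED, imported.
-- stub_tightChainTail — LANDED (assembled, `…TightChainTail.lean`), imported.

/-- STUB B (= `G_free`; OPEN; rated crux-sized / blocked for FREE forecasts beyond one Lanford time; equivalent by
`stub_forecastCapsExist_reduction` (p107089) to the cluster-cardinality tail `ForecastClusterCardTail σ a θ u₀ T ⌊√·⌋₊`;
deleted by a walled/frozen-exterior re-typing of the forecast). -/
theorem stub_forecastCapsExist : ForecastCapsExist := by
  sorry

/-! ## The skeleton theorems -/

/-- **THE SKELETON THEOREM (re-typed target).** `FirstMomentInfluenceLocality` BY NAME: the landed conditional closing theorem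
`firstMoment_of_forecastCaps` applied to the one open stub. -/
theorem FirstMomentInfluenceLocality_of : FirstMomentInfluenceLocality :=
  firstMoment_of_forecastCaps stub_forecastCapsExist

/-- **The exact gap to the TYPED crux.** The typed `AntiMazurCoboundaries.InfluenceLocality` follows from this line only through an
LD UPGRADE `FirstMomentInfluenceLocality → InfluenceLocality`, kept as an EXPLICIT HYPOTHESIS and deliberately NOT a stub (held false
above `lam_c(T,σ,θ)`: steered dispersal cascades; `PICKED.md`, `RETYPE.md`). -/
theorem InfluenceLocality_of_ldUpgrade (upgrade : FirstMomentInfluenceLocality → InfluenceLocality) : InfluenceLocality :=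
  upgrade FirstMomentInfluenceLocality_of

end

end Summit.AtomisticToContinuum.HydrodynamicLimit.Theorems.TrueAnchoredInfection
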